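import Mathlib
import HarnessLib
import Summits.NavierStokesRegularity.NavierStokesRegularity.Theorems.TaylorModelRungThreeCertificateCloserVWin

/-!
# Crux K1b-DR (stmt-NavierStokesRegularity-23954), line `taylor-model` — v3 certificate: the WINDOWED closer with a PER-STAGE growth
# chunk length (ns-tm-g4 g6; engine-1 g69 00:53Z option (iii))

`CertTablesV.k1bDR_of_checksVRGCWinL'` — `k1bDR_of_checksVRGCWin'` (`…CertificateCloserVWin`) with the single chunk length `L`
replaced by a per-stage one `Lj : ℕ → ℕ` (`0 < Lj j`; chunk runs `growthRangeC … j (Lj j) q` for `q·(Lj j) < S j`; `G := GrC … (Lj j)`),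
so that stages re-emitted on a different growth grid (cert-1 j320154: stages 0/2/16/17/18) assemble with the rest.  Nothing else
changes; the per-stage soundness lemmas of `…FormatVGrowthCPairs/CSound` (`facts_atC`, `hR2_of_growthC`, `hR3a_of_growthC`,
`hR3b_of_growthC`) are applied stage by stage.  MODEL-lattice bookkeeping only (rung TL-M3); nothing here is a statement about
the Navier–Stokes equations; K1b-DR is NOT proved here.
-/

-- the sub-problem namespace repeats the summit name by design (D-0017)
set_option linter.dupNamespace false

namespace Summit.NavierStokesRegularity.NavierStokesRegularity.Theorems.TaylorModelCert

namespace CertTablesV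

variable (TV : CertTablesV) (kitOf : ℕ → CoreKit) (wT : ℕ → Array Dyad)

/-- **THE WINDOWED v3 CLOSER FROM BOOLEANS, GROWTH VARIANT C, PER-STAGE CHUNK LENGTH `Lj j`.** [folklore] -/
theorem k1bDR_of_checksVRGCWinL' (sc : ScalarsV) (WV : WindowsV) (A : ReadoutAux QS2) (B : StageAux QS2) (B'' : StaticAux QS2)
    (hcoef : TV.base.checkCoef = true) (hS : TV.base.checkStatic B'' = true)
    (hSN : TV.base.checkStageNumerics A B = true) (hk : KitOK TV kitOf)
    (hnode0 : ∀ j, j ≤ TV.base.N₀ → nodeOK TV.base.n TV.prec (TV.ctxOfW kitOf wT j).N0 = true)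
    (hrB : ∀ j, j ≤ TV.base.N₀ → nonnegVec TV.base.n (TV.stageV j).rB = true)
    (hK : CoreChecksOK TV wT) (hE : ∀ j, j ≤ TV.base.N₀ → TV.checkEntryV j = true)
    (hchk' : TV.checkReadoutsWin' kitOf wT A WV = true) (Lj : ℕ → ℕ) (hL : ∀ j, 0 < Lj j)
    (hGR : ∀ j, j ≤ TV.base.N₀ → ∀ q, q * Lj j < TV.S j →
      TV.growthRangeC kitOf wT (fun _ co => TV.base.testR4 TV.MB (TV.AB j) co) j (Lj j) q = true)
    (hcL : ∀ j, j ≤ TV.base.N₀ → TV.checkL1 j = true) (hc0 : ∀ j, j ≤ TV.base.N₀ → TV.checkR0 j = true)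
    (hc1 : ∀ j, j ≤ TV.base.N₀ → TV.checkR1 wT j = true) :
    Summit.NavierStokesRegularity.NavierStokesRegularity.Theses.ExactWindowRungThree.DerivativeEnclosureCertificateR :=
  have hsteps : ∀ j, j ≤ TV.base.N₀ → ∀ s, s < TV.S j →
      ((TV.ctxOfW kitOf wT j).subStep s ((TV.ctxOfW kitOf wT j).nodeAt s)).ok = true ∧
      (fun _ co => TV.base.testR4 TV.MB (TV.AB j) co) s ((TV.ctxOfW kitOf wT j).subStep s ((TV.ctxOfW kitOf wT j).nodeAt s)).core = true :=
    fun j hj _ hs =>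
      have h := facts_atC (TV := TV) (kitOf := kitOf) (wT := wT) (hL j) (hGR j hj) hs
      ⟨h.1, h.2.1⟩
  have hSNr := TV.stageNumerics_of_checkV kitOf wT sc A B hcoef hSN
  TV.k1bDR_of_checksVRWin' kitOf wT sc WV A B B'' hcoef hS hSN hk ⟨hnode0, hrB, fun j hj s hs => (hsteps j hj s hs).1⟩ hK hE hchk'
    (fun j hj s hs => (hsteps j hj s hs).2) (G := fun j => TV.GrC kitOf wT j (Lj j)) (ΛT := TV.ΛTr)
    (hR0_all (sc := sc) hc0) (hR1_all (sc := sc) hc1)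
    (fun j hj s₀ s₁ h01 hS' Ac hA v r hr hv =>
      hR2_of_growthC (sc := sc) (hL j) (hGR j hj) (hSNr.1 j hj).2.2.2.2.2.2.1 s₀ s₁ h01 hS' Ac hA v r hr hv)
    (fun j hj a b ha hab hb => hR3a_of_growthC (sc := sc) (hL j) (hGR j hj) a b ha hab hb)
    (fun j hj a ha => hR3b_of_growthC (sc := sc) (hL j) (hGR j hj) (hcL j hj) a ha)

end CertTablesV

end Summit.NavierStokesRegularity.NavierStokesRegularity.Theorems.TaylorModelCert
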